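import Summits.BirchSwinnertonDyer.BirchSwinnertonDyer.Theorems.KatoDescentPotSupersingularKatoReciprocityIsotropy
import Summits.BirchSwinnertonDyer.BirchSwinnertonDyer.Theorems.KatoDescentPotSupersingularKatoIsotropicCount
import Summits.BirchSwinnertonDyer.BirchSwinnertonDyer.Theorems.KatoDescentPotSupersingularKummerImagePrimaryCount
import Summits.BirchSwinnertonDyer.BirchSwinnertonDyer.Theorems.KatoDescentPotSupersingularKatoSelmerKummerLift
import Summits.BirchSwinnertonDyer.BirchSwinnertonDyer.Theorems.KatoDescentPotSupersingularKatoFiniteLevelStrictRat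
import Literature.NumberTheory.EllipticCurves.SelmerCorankAssembly
import HarnessLib

/-!
# Brick (a) of crux M's level-0 ledger: the SHARP S-side inequality
# `#S(E[p^∞]) · [B_k : B_k ∩ 𝓚_k^⊥] ≤ #Sel_str^{ur}(E[p^∞]) · p^k`
# for Kato's group `S` (Kummer at `p`, unramified at `ℓ ≠ p`) — abstract in the isotropic subgroup `B_k`
# (route `KatoDescentPotSupersingular` / `…Tame…`, crux M = stmt-BirchSwinnertonDyer-19196; route-free helper)

Seat `bsd-potss-rkm` g19 (prover; cell `bsd-potss`), item stmt-BirchSwinnertonDyer-19196 (`--supports … --as helper`; closes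
nothing).  HONEST FRAMING: BSD is not proved by any of this; nothing is booked; theorems only (no definition, no named fact).

## What (memo `HOME/rkm/FINDING-19196-rkm-g18.md` §ARCHITECTURE, steps L2–L5 assembled; `K = ℚ`, `P = {v_p}`, `p` odd)

Kato's group `S = S(E[p^∞]) ≤ H¹(ℚ, E[p^∞])` (Astérisque 295, §14.8) is spelled WITHOUT a new definition as
`H¹_{𝓤∞}(ℚ, E[p^∞]) ⊓ selmerLocalKerPrimary W ℚ_p p` — `𝓤∞` the Selmer structure `⊤` at `v_p`, UNRAMIFIED at every `ℓ ≠ p`, `⊤` at `∞`;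
the second factor = "dies in `H¹(ℚ_p, E)`" = the `p^∞` Kummer condition at `p` — and `Sel_str^{ur} = H¹_{𝓢∞}` with `𝓢∞` ZERO at `v_p` and
otherwise equal to `𝓤∞` (seat g17's dialect).  At level `p^k` (`k = m + e`, `p^m · S = 0`): `𝓚 = 𝓚_k ≤ H¹(ℚ_p, E[p^k])` the local Kummer
condition, `b = ⟨·,·⟩_p = inv_p(· ∪_{ev} ·)` the local Tate pairing of a Poitou–Tate family `inv` at an odd level `N` with `p^k ∣ N`,
`g : E[p^k] → E[p^k]^D` ANY equivariant map, `A' ≤ H¹(ℚ, E[p^k])` ANY subgroup of classes unramified off `p`, and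
`Y = B_k := loc_p g_* A' ≤ H¹(ℚ_p, E[p^k]^D)`.

* `selmerGroup_strict_eq_kato_inf_ker` — `Sel_str^{ur} = S ⊓ ker loc_p`; `natCard_kato_eq_mul` — **`#S = #Sel_str^{ur} · #loc_p(S)`**.
* `map_localization_kato_le` — **`loc_p(S) ≤ ι_k(𝓚 ⊓ {}^⊥Y)`**: lift `c = ι_k c'` with `c'` unramified off `p` (part 34
  `exists_map_primaryInclusion_eq_of_unramified_outside`); `loc_p c' ∈ 𝓚` because the Kummer condition is the kernel of
  `H¹(ℚ_p,E[p^k]) → H¹(ℚ_p,E)` and this factors through `ι_k` (`selmerLocalKer_eq_comap`, `selmerLocalKerPrimary_eq_comap`,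
  `(E[p^∞] ↪ E)_* ∘ H¹(ι_k) = (E[p^k] ↪ E)_*`); `loc_p c' ∈ {}^⊥Y` by RECIPROCITY (part 31
  `localTerm_inr_eq_zero_of_unramified_outside_singleton`: both `c'` and `g_* a` are unramified off `p`, `N` odd).
* **`natCard_kato_mul_relIndex_le_of_ker_le`** (MAIN): if `ker ι_k ≤ {}^⊥Y` (hypothesis `hZ`; discharged for the descended-Weil transport of
  tower classes by part 35 `ker_map_primaryInclusion_le_annLeft`) then
  **`#S · [Y : Y ⊓ 𝓚^⊥] ≤ #Sel_str^{ur} · p^k`** — from `#loc_p(S) ≤ #ι_k(𝓚 ⊓ {}^⊥Y)`, `#ι_k(X)·#E(ℚ_p)[p^k] = #X` for `X ≥ ker ι_k`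
  (part 33), `#(𝓚 ⊓ {}^⊥Y)·[Y : Y ⊓ 𝓚^⊥] = #𝓚` (part 32, local duality at `v_p`) and `#𝓚 = #E(ℚ_p)[p^k]·p^k` (g17): the torsion
  `#E(ℚ_p)[p^k]` CANCELS — no loss `p^{t_p}`.  This is brick (a) `#S ≤ #Sel_str^{ur} · p^k/#im_k`, `im_k = Y/(Y ⊓ 𝓚^⊥)`, the
  finite-level currency in which brick (b) (Kato 14.18 / `HasLocPKummerLog`) supplies `#im_k(ℤ_p z_Kato) ≥ p^{k−(a+t_p−v_p(c_p)+…)}`.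

References: K. Kato, Astérisque 295 (2004), §14.8 (p. 238), Prop. 14.16 and its proof (pp. 244–245) [Kato2004Asterisque]; J. S. Milne,
*ADT* I Cor. 2.3, Thm. 2.6, Lemma 3.3, Thm. 4.10 (b), §6 [MilneADT2006]; R. Greenberg, LNM 1716 §3 Lemma 3.3, §5 Prop. 5.8 [GreenbergLNM1716].
-/

-- the summit and its single problem are both named `BirchSwinnertonDyer` (registry layout D-0017)
set_option linter.dupNamespace false
set_option autoImplicit false

noncomputable section

open scoped Classical ContRepresentation NumberField
open Function Field NumberField IsDedekindDomain WeierstrassCurve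
open Literature.NumberTheory.EllipticCurves Literature.NumberTheory.GaloisRepresentations
  Literature.NumberTheory.GaloisRepresentations.DiscreteGaloisModule Literature.NumberTheory.GaloisCohomology
open Literature.NumberTheory.EllipticCurves.Kato2004
open Summit.BirchSwinnertonDyer.Rank1Residual.X11b.Levels Summit.BirchSwinnertonDyer.Rank1Residual.X11b.LocBridge
  Summit.BirchSwinnertonDyer.Rank1Residual.X11b.LevelKummer Summit.BirchSwinnertonDyer.Rank1Residual.X11b.FiniteDuality
open Summit.BirchSwinnertonDyer.Rank1Residual.GaloisImage
open Summit.BirchSwinnertonDyer.BirchSwinnertonDyer.Rank1Residual (StepFour.localization_map_mem_unramifiedSubgroup)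

universe u

namespace Summit.BirchSwinnertonDyer.BirchSwinnertonDyer.Theorems.KatoFiniteLevelCount

/-! ## §1 `(E[p^∞] ↪ E)_* ∘ H¹(ι_k) = (E[p^k] ↪ E)_*` and the Kummer condition through `ι_k` -/

section Bridge

variable {K : Type u} [Field K] (W : WeierstrassCurve K) (p k : ℕ)

/-- **`(E[p^∞] ↪ E)_* ∘ H¹(ι_k) = (E[p^k] ↪ E)_*`** on `H¹(K, ·)` (functoriality of `H¹` in the coefficients; the `K : Type`
case is bsd-cn100's `primaryH1ToH1_comp_map_primaryInclusion`, restated universe-polymorphically). [cite: GreenbergLNM1716, §5 proof of Prop. 5.8] -/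
theorem primaryH1ToH1_map_primaryInclusion_eq (c : galoisCohomology (W.torsionGaloisModule ((p ^ k : ℕ) : ℤ)) 1) :
    primaryH1ToH1 W p (galoisCohomology.map (primaryInclusion W p k) 1 c) = torsionH1ToH1 W ((p ^ k : ℕ) : ℤ) c := by
  have h : (primaryH1ToH1 W p).comp
      (resH1Hom (ContinuousMonoidHom.id (Field.absoluteGaloisGroup K))
        (AddSubgroup.inclusion (geomTorsion_pow_le_geomPrimaryTorsion W p k)) (fun _ _ ↦ rfl) :
        galH1Torsion W ((p ^ k : ℕ) : ℤ) →+ galH1Primary W p) = torsionH1ToH1 W ((p ^ k : ℕ) : ℤ) := by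
    rw [primaryH1ToH1, resH1Hom_comp, torsionH1ToH1_eq_resH1Hom]
    exact resH1Hom_congr rfl (AddMonoidHom.ext fun _ ↦ rfl) _ _
  exact DFunLike.congr_fun h c

variable (E : Type u) [Field E] [Algebra K E]

/-- **`c' ∈ selmerLocalKer ⟺ ι_k c' ∈ selmerLocalKerPrimary`**: a level-`p^k` class dies in `H¹(E, E)` iff its image in
`H¹(K, E[p^∞])` does (both are preimages of `ker(H¹(K,E) → H¹(E,E))`, `selmerLocalKer_eq_comap` / `selmerLocalKerPrimary_eq_comap`, and §1).
[cite: SilvermanAEC2009, X.§4 diagram (**)] [cite: GreenbergLNM1716, §2 p. 63] -/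
theorem mem_selmerLocalKer_iff_map_primaryInclusion_mem (c : galoisCohomology (W.torsionGaloisModule ((p ^ k : ℕ) : ℤ)) 1) :
    c ∈ selmerLocalKer W E ((p ^ k : ℕ) : ℤ) ↔
      galoisCohomology.map (primaryInclusion W p k) 1 c ∈ selmerLocalKerPrimary W E p := by
  rw [W.selmerLocalKer_eq_comap E, W.selmerLocalKerPrimary_eq_comap E p]
  change torsionH1ToH1 W ((p ^ k : ℕ) : ℤ) c ∈ W.localRestrictionKer E ↔
    primaryH1ToH1 W p (galoisCohomology.map (primaryInclusion W p k) 1 c) ∈ W.localRestrictionKer E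
  rw [primaryH1ToH1_map_primaryInclusion_eq]

variable [NumberField K]

/-- **`loc_v c' ∈ 𝓚_v ⟺ ι_k c' ∈ selmerLocalKerPrimary W K_v p`**: the local Kummer condition at `v` of a level-`p^k` class is read
off its image in `H¹(K, E[p^∞])`. [cite: SilvermanAEC2009, X.§4 diagram (**)] [cite: MilneADT2006, I §6 (6.14)] -/
theorem localization_mem_kummerSelmerStructure_iff_map_primaryInclusion_mem (v : Place K)
    (c : galoisCohomology (W.torsionGaloisModule ((p ^ k : ℕ) : ℤ)) 1) :
    galoisCohomology.localization (W.torsionGaloisModule ((p ^ k : ℕ) : ℤ)) v 1 c ∈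
        W.kummerSelmerStructure ((p ^ k : ℕ) : ℤ) v ↔
      galoisCohomology.map (primaryInclusion W p k) 1 c ∈ selmerLocalKerPrimary W (Place.Completion v) p := by
  rw [← AddSubgroup.mem_comap, W.comap_localization_kummerSelmerStructure ((p ^ k : ℕ) : ℤ) v]
  exact mem_selmerLocalKer_iff_map_primaryInclusion_mem W p k (Place.Completion v) c

end Bridge

/-! ## §2 Kato's `S` over `ℚ`: `Sel_str^{ur} = S ⊓ ker loc_p` and `#S = #Sel_str^{ur} · #loc_p(S)` -/

section Rat

variable (W : WeierstrassCurve ℚ) [W.IsElliptic] (p : ℕ) [Fact p.Prime]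
  (𝓤inf 𝓢inf : SelmerStructure (primaryGaloisModule W p))

omit [W.IsElliptic] in
/-- **`Sel_str^{ur}(ℚ, E[p^∞]) = S ⊓ ker loc_p`**: Kato's strict group (zero at `v_p`, unramified at `ℓ ≠ p`) is the kernel of `loc_p` on his
group `S` (Kummer at `p`, unramified at `ℓ ≠ p`) — a class vanishing at `v_p` satisfies the `p^∞` Kummer condition there
(g17 `mem_selmerLocalKerPrimary_of_localization_eq_zero`). [cite: Kato2004Asterisque, §14.8 (p. 238) and (14.9.4) (p. 240)] -/
theorem selmerGroup_strict_eq_kato_inf_ker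
    (hUp : 𝓤inf (Sum.inr (primePlace p)) = ⊤)
    (hUS : ∀ v : Place ℚ, v ≠ Sum.inr (primePlace p) → 𝓢inf v = 𝓤inf v)
    (hSp : 𝓢inf (Sum.inr (primePlace p)) = ⊥) :
    𝓢inf.selmerGroup = (𝓤inf.selmerGroup ⊓ selmerLocalKerPrimary W ((primePlace p).adicCompletion ℚ) p) ⊓
      (galoisCohomology.localization (primaryGaloisModule W p) (Sum.inr (primePlace p)) 1).ker := by
  ext c
  simp only [AddSubgroup.mem_inf, SelmerStructure.mem_selmerGroup_iff, AddMonoidHom.mem_ker]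
  constructor
  · intro hc
    have h0 : galoisCohomology.localization (primaryGaloisModule W p) (Sum.inr (primePlace p)) 1 c = 0 := by
      have h := hc (Sum.inr (primePlace p)); rwa [hSp, AddSubgroup.mem_bot] at h
    refine ⟨⟨fun v => ?_, mem_selmerLocalKerPrimary_of_localization_eq_zero W p _ c h0⟩, h0⟩
    by_cases hv : v = Sum.inr (primePlace p)
    · subst hv; rw [hUp]; exact AddSubgroup.mem_top _
    · rw [← hUS v hv]; exact hc v
  · rintro ⟨⟨hU, -⟩, h0⟩ v
    by_cases hv : v = Sum.inr (primePlace p)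
    · subst hv; rw [hSp, AddSubgroup.mem_bot]; exact h0
    · rw [hUS v hv]; exact hU v

omit [W.IsElliptic] in
/-- **`#S = #Sel_str^{ur} · #loc_p(S)`** for Kato's `S = H¹_{𝓤∞} ⊓ selmerLocalKerPrimary` and `Sel_str^{ur} = H¹_{𝓢∞}` (orders as `Nat.card`).
[cite: Kato2004Asterisque, §14.8 (p. 238) and proof of Prop. 14.16 (pp. 244–245)] -/
theorem natCard_kato_eq_mul
    (hUp : 𝓤inf (Sum.inr (primePlace p)) = ⊤)
    (hUS : ∀ v : Place ℚ, v ≠ Sum.inr (primePlace p) → 𝓢inf v = 𝓤inf v)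
    (hSp : 𝓢inf (Sum.inr (primePlace p)) = ⊥) :
    Nat.card ↥(𝓤inf.selmerGroup ⊓ selmerLocalKerPrimary W ((primePlace p).adicCompletion ℚ) p) =
      Nat.card 𝓢inf.selmerGroup *
        Nat.card ((𝓤inf.selmerGroup ⊓ selmerLocalKerPrimary W ((primePlace p).adicCompletion ℚ) p).map
          (galoisCohomology.localization (primaryGaloisModule W p) (Sum.inr (primePlace p)) 1)) := by
  set S := 𝓤inf.selmerGroup ⊓ selmerLocalKerPrimary W ((primePlace p).adicCompletion ℚ) p
  set loc := galoisCohomology.localization (primaryGaloisModule W p) (Sum.inr (primePlace p)) 1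
  have hSel : 𝓢inf.selmerGroup = S ⊓ loc.ker := selmerGroup_strict_eq_kato_inf_ker W p 𝓤inf 𝓢inf hUp hUS hSp
  have hle : 𝓢inf.selmerGroup ≤ S := by rw [hSel]; exact inf_le_left
  have h2 : 𝓢inf.selmerGroup.relIndex S = Nat.card (S.map loc) := by
    rw [hSel, inf_comm, AddSubgroup.inf_relIndex_right, relIndex_ker_eq_natCard_map]
  -- `#Sel · [S : Sel] = #S`
  have h1 : Nat.card 𝓢inf.selmerGroup * 𝓢inf.selmerGroup.relIndex S = Nat.card S := by
    rw [AddSubgroup.relIndex, ← Nat.card_congr (AddSubgroup.addSubgroupOfEquivOfLe hle).toEquiv]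
    exact AddSubgroup.card_mul_index _
  rw [← h1, h2]

end Rat

/-! ## §3 `loc_p(S) ≤ ι_k(𝓚_k ⊓ {}^⊥Y)` and the sharp count -/

section Count

variable (W : WeierstrassCurve ℚ) [W.IsElliptic] (p : ℕ) [Fact p.Prime] (m e : ℕ)
  (𝓤inf 𝓢inf : SelmerStructure (primaryGaloisModule W p))
  -- `E[p^k]` is finite (tree `finite_geomTorsion_of_neZero`, X11b `finite_geomTorsion_pow`); an instance hypothesis, so that no
  -- local instance is declared in this file
  [Finite (geomTorsion W ((p ^ (m + e) : ℕ) : ℤ))]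
  {N : ℕ} [NeZero N] (inv : LocalInvariants ℚ N)
  (g : (W.torsionGaloisModule ((p ^ (m + e) : ℕ) : ℤ)).toContRepresentation →ⁱL
    ((W.torsionGaloisModule ((p ^ (m + e) : ℕ) : ℤ)).tateDual N).toContRepresentation)
  (A' : AddSubgroup (galoisCohomology (W.torsionGaloisModule ((p ^ (m + e) : ℕ) : ℤ)) 1))

/-- **`loc_p(S) ≤ ι_k(𝓚_k ⊓ {}^⊥Y)`** (`k = m+e`, `p^m · S = 0`): for `c ∈ S` take the lift `c'` (part 34; unramified off `p`,
`ι_k c' = c`); `loc_p c' ∈ 𝓚_k` (§1: the Kummer condition at level `p^k` is read off `ι_k c' = c ∈ selmerLocalKerPrimary`) and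
`loc_p c' ⊥ loc_p g_* a` for every `a ∈ A'` (reciprocity, part 31: `c'`, `g_* a` unramified off `p`, `N` odd); and
`loc_p c = ι_k loc_p c'`.  Here `Y = loc_p g_* A'`. [cite: Kato2004Asterisque, proof of Prop. 14.16 (pp. 244–245)]
[cite: MilneADT2006, Ch. I, Thm. 4.10 (b) and Thm. 2.6] -/
theorem map_localization_kato_le (hN : Odd N) (hkN : p ^ (m + e) ∣ N) (hsum : inv.SumLocalTermEqZero)
    (hUur : ∀ v : HeightOneSpectrum (𝓞 ℚ), v ≠ primePlace p →
      𝓤inf (Sum.inr v) = unramifiedSubgroup (GaloisRep.toLocal v (primaryGaloisModule W p)) 1)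
    (hm : ∀ c ∈ 𝓤inf.selmerGroup ⊓ selmerLocalKerPrimary W ((primePlace p).adicCompletion ℚ) p, p ^ m • c = 0)
    (hNur : ∀ v : HeightOneSpectrum (𝓞 ℚ), v ≠ primePlace p → ∀ x : W.geomPrimaryTorsion p,
      (∀ τ ∈ absInertia (v.adicCompletion ℚ), GaloisRep.toLocal v (primaryGaloisModule W p) τ x = x) →
        ∃ d : W.geomPrimaryTorsion p,
          (∀ τ ∈ absInertia (v.adicCompletion ℚ), GaloisRep.toLocal v (primaryGaloisModule W p) τ d = d) ∧
            p ^ (m + e) • d = p ^ e • x)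
    (hA' : ∀ a ∈ A', ∀ v : HeightOneSpectrum (𝓞 ℚ), v ≠ primePlace p →
      galoisCohomology.localization (W.torsionGaloisModule ((p ^ (m + e) : ℕ) : ℤ)) (Sum.inr v) 1 a ∈
        unramifiedSubgroup (GaloisRep.toLocal v (W.torsionGaloisModule ((p ^ (m + e) : ℕ) : ℤ))) 1) :
    (𝓤inf.selmerGroup ⊓ selmerLocalKerPrimary W ((primePlace p).adicCompletion ℚ) p).map
        (galoisCohomology.localization (primaryGaloisModule W p) (Sum.inr (primePlace p)) 1) ≤
      (W.kummerSelmerStructure ((p ^ (m + e) : ℕ) : ℤ) (Sum.inr (primePlace p)) ⊓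
        annLeft (localTatePairingZMod (W.torsionGaloisModule ((p ^ (m + e) : ℕ) : ℤ)) N (Sum.inr (primePlace p))
          (inv (Sum.inr (primePlace p))))
          ((A'.map (galoisCohomology.map g 1)).map
            (galoisCohomology.localization ((W.torsionGaloisModule ((p ^ (m + e) : ℕ) : ℤ)).tateDual N)
              (Sum.inr (primePlace p)) 1))).map
        (galoisCohomology.map ((primaryInclusion W p (m + e)).restrictField ((primePlace p).adicCompletion ℚ)) 1) := by
  rintro _ ⟨c, hc, rfl⟩
  have hcU := (SelmerStructure.mem_selmerGroup_iff _ _).1 hc.1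
  -- the lift
  obtain ⟨c', hc'c, hc'ur⟩ := exists_map_primaryInclusion_eq_of_unramified_outside W p m e {primePlace p}
    (fun v hv => hNur v (fun h => hv (Finset.mem_singleton.2 h)))
    (c := c) (fun v hv => by
      have h := hcU (Sum.inr v)
      rwa [hUur v (fun h' => hv (Finset.mem_singleton.2 h'))] at h) (hm c hc)
  -- Kummer at `p`
  have hK : galoisCohomology.localization (W.torsionGaloisModule ((p ^ (m + e) : ℕ) : ℤ)) (Sum.inr (primePlace p)) 1 c' ∈
      W.kummerSelmerStructure ((p ^ (m + e) : ℕ) : ℤ) (Sum.inr (primePlace p)) := by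
    rw [localization_mem_kummerSelmerStructure_iff_map_primaryInclusion_mem, hc'c]
    exact hc.2
  -- isotropy against `Y = loc_p g_* A'`
  have hM : ∀ x : geomTorsion W ((p ^ (m + e) : ℕ) : ℤ), N • x = 0 := fun x => by
    obtain ⟨c₀, hc₀⟩ := hkN
    rw [hc₀, mul_comm, mul_smul, pow_nsmul_geomTorsion_eq_zero, smul_zero]
  have hiso : galoisCohomology.localization (W.torsionGaloisModule ((p ^ (m + e) : ℕ) : ℤ)) (Sum.inr (primePlace p)) 1 c' ∈
      annLeft (localTatePairingZMod (W.torsionGaloisModule ((p ^ (m + e) : ℕ) : ℤ)) N (Sum.inr (primePlace p))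
          (inv (Sum.inr (primePlace p))))
        ((A'.map (galoisCohomology.map g 1)).map
          (galoisCohomology.localization ((W.torsionGaloisModule ((p ^ (m + e) : ℕ) : ℤ)).tateDual N)
            (Sum.inr (primePlace p)) 1)) := by
    rintro _ ⟨_, ⟨a, ha, rfl⟩, rfl⟩
    have h := localTerm_inr_eq_zero_of_unramified_outside_singleton hN hsum (W.torsionGaloisModule ((p ^ (m + e) : ℕ) : ℤ)) hM
      (primePlace p) c' (galoisCohomology.map g 1 a)
      (fun v hv => hc'ur v (fun h' => hv (Finset.mem_singleton.1 h')))
      (fun v hv => StepFour.localization_map_mem_unramifiedSubgroup g v (hA' a ha v hv))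
    rwa [LocalInvariants.localTerm_apply, ← DiscreteGaloisModule.localTatePairingZMod_apply] at h
  -- `loc_p c = ι_k (loc_p c')`
  have hnat : galoisCohomology.localization (primaryGaloisModule W p) (Sum.inr (primePlace p)) 1 c =
      galoisCohomology.map ((primaryInclusion W p (m + e)).restrictField ((primePlace p).adicCompletion ℚ)) 1
        (galoisCohomology.localization (W.torsionGaloisModule ((p ^ (m + e) : ℕ) : ℤ)) (Sum.inr (primePlace p)) 1 c') := by
    rw [← hc'c, localization_map_one']
    rfl
  exact ⟨_, AddSubgroup.mem_inf.2 ⟨hK, hiso⟩, hnat.symm⟩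

/-- **Brick (a), SHARP S-side inequality: `#S · [Y : Y ⊓ 𝓚^⊥] ≤ #Sel_str^{ur} · p^k`** (`K = ℚ`, ANY prime `p` — oddness enters only
through the odd auxiliary level `N`; `k = m + e` with `p^m · S = 0` and
(hN) off `p` at `(m, e)`; `inv` a Poitou–Tate family at an odd level `N`, `p^k ∣ N`, perfect at `v_p`; `g : E[p^k] → E[p^k]^D` ANY equivariant
map; `A' ≤ H¹(ℚ, E[p^k])` ANY subgroup of classes unramified off `p`; `Y = loc_p g_* A'`; `hZ : ker ι_k ≤ {}^⊥Y`).  With `Y = B_k` the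
descended-Weil transport of `loc_p red_{p^k}(H¹(ℤ[1/p], T_pE))` (`hZ` by part 35) this is `#S(E[p^∞]) ≤ #Sel_str^{ur} · p^k/#im_k(A)` of
the memo: NO loss of the local torsion `p^{t_p}` (it cancels between `#𝓚_k = p^k·#E(ℚ_p)[p^k]` and `#ker ι_k = #E(ℚ_p)[p^k]`).
[cite: Kato2004Asterisque, proof of Prop. 14.16 (pp. 244–245)] [cite: MilneADT2006, Ch. I, Cor. 2.3, Thm. 2.6, Lemma 3.3, Thm. 4.10 (b)] -/
theorem natCard_kato_mul_relIndex_le_of_ker_le (hN : Odd N) (hkN : p ^ (m + e) ∣ N)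
    (hsum : inv.SumLocalTermEqZero) (hperf : inv.IsPerfect)
    (hUp : 𝓤inf (Sum.inr (primePlace p)) = ⊤)
    (hUur : ∀ v : HeightOneSpectrum (𝓞 ℚ), v ≠ primePlace p →
      𝓤inf (Sum.inr v) = unramifiedSubgroup (GaloisRep.toLocal v (primaryGaloisModule W p)) 1)
    (hUinl : ∀ w : InfinitePlace ℚ, 𝓤inf (Sum.inl w) = ⊤)
    (hSp : 𝓢inf (Sum.inr (primePlace p)) = ⊥)
    (hSur : ∀ v : HeightOneSpectrum (𝓞 ℚ), v ≠ primePlace p →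
      𝓢inf (Sum.inr v) = unramifiedSubgroup (GaloisRep.toLocal v (primaryGaloisModule W p)) 1)
    (hSinl : ∀ w : InfinitePlace ℚ, 𝓢inf (Sum.inl w) = ⊤)
    (hm : ∀ c ∈ 𝓤inf.selmerGroup ⊓ selmerLocalKerPrimary W ((primePlace p).adicCompletion ℚ) p, p ^ m • c = 0)
    (hNur : ∀ v : HeightOneSpectrum (𝓞 ℚ), v ≠ primePlace p → ∀ x : W.geomPrimaryTorsion p,
      (∀ τ ∈ absInertia (v.adicCompletion ℚ), GaloisRep.toLocal v (primaryGaloisModule W p) τ x = x) →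
        ∃ d : W.geomPrimaryTorsion p,
          (∀ τ ∈ absInertia (v.adicCompletion ℚ), GaloisRep.toLocal v (primaryGaloisModule W p) τ d = d) ∧
            p ^ (m + e) • d = p ^ e • x)
    (hA' : ∀ a ∈ A', ∀ v : HeightOneSpectrum (𝓞 ℚ), v ≠ primePlace p →
      galoisCohomology.localization (W.torsionGaloisModule ((p ^ (m + e) : ℕ) : ℤ)) (Sum.inr v) 1 a ∈
        unramifiedSubgroup (GaloisRep.toLocal v (W.torsionGaloisModule ((p ^ (m + e) : ℕ) : ℤ))) 1)
    (hZ : (galoisCohomology.map ((primaryInclusion W p (m + e)).restrictField ((primePlace p).adicCompletion ℚ)) 1).ker ≤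
      annLeft (localTatePairingZMod (W.torsionGaloisModule ((p ^ (m + e) : ℕ) : ℤ)) N (Sum.inr (primePlace p))
        (inv (Sum.inr (primePlace p))))
        ((A'.map (galoisCohomology.map g 1)).map
          (galoisCohomology.localization ((W.torsionGaloisModule ((p ^ (m + e) : ℕ) : ℤ)).tateDual N)
            (Sum.inr (primePlace p)) 1))) :
    Nat.card ↥(𝓤inf.selmerGroup ⊓ selmerLocalKerPrimary W ((primePlace p).adicCompletion ℚ) p) *
        ((A'.map (galoisCohomology.map g 1)).map
            (galoisCohomology.localization ((W.torsionGaloisModule ((p ^ (m + e) : ℕ) : ℤ)).tateDual N)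
              (Sum.inr (primePlace p)) 1) ⊓
          annRight (localTatePairingZMod (W.torsionGaloisModule ((p ^ (m + e) : ℕ) : ℤ)) N (Sum.inr (primePlace p))
            (inv (Sum.inr (primePlace p)))) (W.kummerSelmerStructure ((p ^ (m + e) : ℕ) : ℤ) (Sum.inr (primePlace p)))).relIndex
          ((A'.map (galoisCohomology.map g 1)).map
            (galoisCohomology.localization ((W.torsionGaloisModule ((p ^ (m + e) : ℕ) : ℤ)).tateDual N)
              (Sum.inr (primePlace p)) 1)) ≤
      Nat.card 𝓢inf.selmerGroup * p ^ (m + e) := by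
  -- notation (no `set` on terms occurring in the types of `g`, `A'`)
  set S := 𝓤inf.selmerGroup ⊓ selmerLocalKerPrimary W ((primePlace p).adicCompletion ℚ) p with hS
  set loc := galoisCohomology.localization (primaryGaloisModule W p) (Sum.inr (primePlace p)) 1 with hloc
  set b := localTatePairingZMod (W.torsionGaloisModule ((p ^ (m + e) : ℕ) : ℤ)) N (Sum.inr (primePlace p))
    (inv (Sum.inr (primePlace p))) with hb
  set 𝓚 := W.kummerSelmerStructure ((p ^ (m + e) : ℕ) : ℤ) (Sum.inr (primePlace p)) with h𝓚
  set Y := (A'.map (galoisCohomology.map g 1)).map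
    (galoisCohomology.localization ((W.torsionGaloisModule ((p ^ (m + e) : ℕ) : ℤ)).tateDual N)
      (Sum.inr (primePlace p)) 1) with hY
  set ι := galoisCohomology.map ((primaryInclusion W p (m + e)).restrictField ((primePlace p).adicCompletion ℚ)) 1 with hι
  set T := Nat.card (nsmulAddMonoidHom (p ^ (m + e)) :
    (W.baseChange ((primePlace p).adicCompletion ℚ)).toAffine.Point →+ _).ker with hT
  have hp : p.Prime := Fact.out
  have hpk : p ^ (m + e) ≠ 0 := pow_ne_zero (m + e) hp.ne_zero
  -- finiteness and torsion at `v_p`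
  haveI : Finite (galoisCohomology ((W.torsionGaloisModule ((p ^ (m + e) : ℕ) : ℤ)).toLocal (Sum.inr (primePlace p))) 1) :=
    finite_galoisCohomology_one_toLocal _ _
  haveI : Finite (galoisCohomology
      (((W.torsionGaloisModule ((p ^ (m + e) : ℕ) : ℤ)).tateDual N).toLocal (Sum.inr (primePlace p))) 1) :=
    finite_galoisCohomology_one_tateDual_toLocal _ N _
  haveI : Finite 𝓚 := W.finite_kummerSelmerStructure_inr (primePlace p) hpk
  haveI := W.finite_ker_nsmul_adicCompletion (primePlace p) hpk
  have hM : ∀ x : geomTorsion W ((p ^ (m + e) : ℕ) : ℤ), N • x = 0 := fun x => by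
    obtain ⟨c₀, hc₀⟩ := hkN
    rw [hc₀, mul_comm, mul_smul, pow_nsmul_geomTorsion_eq_zero, smul_zero]
  have hA : ∀ x : galoisCohomology ((W.torsionGaloisModule ((p ^ (m + e) : ℕ) : ℤ)).toLocal (Sum.inr (primePlace p))) 1,
      N • x = 0 := galoisCohomology.nsmul_eq_zero_of_forall _ hM
  have hB : ∀ y : galoisCohomology
      (((W.torsionGaloisModule ((p ^ (m + e) : ℕ) : ℤ)).tateDual N).toLocal (Sum.inr (primePlace p))) 1, N • y = 0 :=
    galoisCohomology.nsmul_eq_zero_of_forall _ fun f => DiscreteGaloisModule.TateDual.nsmul_eq_zero f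
  obtain ⟨hb1, hb2⟩ := (hperf (primePlace p)).2 (W.torsionGaloisModule ((p ^ (m + e) : ℕ) : ℤ)) hM
  -- (1) `#S = #Sel_str · #loc(S)`
  have hUS : ∀ v : Place ℚ, v ≠ Sum.inr (primePlace p) → 𝓢inf v = 𝓤inf v := by
    rintro (w | v) hv
    · rw [hSinl, hUinl]
    · have hv' : v ≠ primePlace p := fun h => hv (by rw [h])
      rw [hSur v hv', hUur v hv']
  have h1 : Nat.card S = Nat.card 𝓢inf.selmerGroup * Nat.card (S.map loc) := natCard_kato_eq_mul W p 𝓤inf 𝓢inf hUp hUS hSp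
  -- (2) `loc(S) ≤ ι(𝓚 ⊓ ⊥Y)`, so `#loc(S) ≤ #ι(𝓚 ⊓ ⊥Y)`
  have h2le : S.map loc ≤ (𝓚 ⊓ annLeft b Y).map ι :=
    map_localization_kato_le W p m e 𝓤inf inv g A' hN hkN hsum hUur hm hNur hA'
  have h2 : Nat.card (S.map loc) ≤ Nat.card ((𝓚 ⊓ annLeft b Y).map ι) := by
    haveI : Finite ↥(𝓚 ⊓ annLeft b Y) :=
      Finite.of_injective (AddSubgroup.inclusion (inf_le_left : 𝓚 ⊓ annLeft b Y ≤ 𝓚)) (AddSubgroup.inclusion_injective _)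
    -- the image of a finite subgroup is finite (instance supplied against the exact type of `h2le`)
    refine @AddSubgroup.card_le_of_le _ _ _ _ ?_ h2le
    exact Finite.of_surjective (fun x : ↥(𝓚 ⊓ annLeft b Y) => ⟨ι x.1, ⟨x.1, x.2, rfl⟩⟩)
      (by rintro ⟨y, x, hx, rfl⟩; exact ⟨⟨x, hx⟩, rfl⟩)
  -- (3) `#ι(𝓚 ⊓ ⊥Y) · T = #(𝓚 ⊓ ⊥Y)` (`ker ι ≤ 𝓚 ⊓ ⊥Y`)
  have h3 : Nat.card ((𝓚 ⊓ annLeft b Y).map ι) * T = Nat.card ↥(𝓚 ⊓ annLeft b Y) :=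
    natCard_map_primaryInclusion_mul_of_ker_le W p (m + e) (primePlace p)
      (le_inf (ker_map_primaryInclusion_le_kummerLocalConditionAt W p (m + e) _) hZ)
  -- (4) `#(𝓚 ⊓ ⊥Y) · [Y : Y ⊓ 𝓚^⊥] = #𝓚 = T · p^k`
  have h4 : Nat.card ↥(𝓚 ⊓ annLeft b Y) * (Y ⊓ annRight b 𝓚).relIndex Y = Nat.card 𝓚 :=
    natCard_inf_annLeft_mul_relIndex hA hB b hb1 hb2 𝓚 Y
  have h5 : Nat.card 𝓚 = T * p ^ (m + e) := natCard_kummerSelmerStructure_primePlace W p (m + e)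
  -- assemble: `#S · [Y : Y ⊓ 𝓚^⊥] · T ≤ #Sel · p^k · T`
  have hTpos : 0 < T := Nat.card_pos
  refine Nat.le_of_mul_le_mul_right ?_ hTpos
  calc Nat.card S * (Y ⊓ annRight b 𝓚).relIndex Y * T
      = Nat.card 𝓢inf.selmerGroup * (Nat.card (S.map loc) * T * (Y ⊓ annRight b 𝓚).relIndex Y) := by rw [h1]; ring
    _ ≤ Nat.card 𝓢inf.selmerGroup * (Nat.card ((𝓚 ⊓ annLeft b Y).map ι) * T * (Y ⊓ annRight b 𝓚).relIndex Y) := by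
        gcongr
    _ = Nat.card 𝓢inf.selmerGroup * p ^ (m + e) * T := by rw [h3, h4, h5]; ring

end Count

end Summit.BirchSwinnertonDyer.BirchSwinnertonDyer.Theorems.KatoFiniteLevelCount

end
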